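import Literature.MathematicalPhysics.QuantumFieldTheory.Balaban1983to89.B9Thm312WholeBlocksRel
import Literature.MathematicalPhysics.QuantumFieldTheory.Balaban1983to89.B9RWSumsReadsNbr
import Literature.MathematicalPhysics.QuantumFieldTheory.Balaban1983to89.B9RWSums346SecondDiff

/-!
# `Balaban1983to89.B9Thm312WholeBlocksNbr` — [B9] Theorem 3.12 (p. 423): the L² BLOCK (3.46) and the HÖLDER BLOCK (3.43)–(3.45) of a
# kernel family CO-READ ON THE METRIC NEIGHBOURHOOD OF y (n06-k's `Nbr` species) by a Sect.-D propagator A ∈ {G, G₁}, at one member and one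
# configuration, from the operator-level schemas — with the second-order L² lines (3.46)₃,₅ modelled PRINT-FAITHFULLY by the DIRECTION-PAIR
# families ∇_{U,ν}∇_{U,μ}A and A∇\*_{U,ν}∇\*_{U,μ}, DERIVED from Theorem 3.3 for G₀ and the step by r1-g6's Neumann bookkeeping

T. Bałaban, *Propagators for lattice gauge theories in a background field*, Commun. Math. Phys. **99** (1985) 389–434
[`Balaban1985BackgroundPropagators`, "B9"]; [4] = T. Bałaban, *Propagators and renormalization transformations for lattice
gauge theories. II*, Commun. Math. Phys. **96** (1984) 223–250 [`Balaban1984PropagatorsII`].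

statement-level skeleton of published theorems with citation tags; proofs where landed; nothing here is a claim about the
Yang–Mills mass gap

THE PRINTED LOCI (verbatim).  (3.46) p. 398 ll. 19–22 (lit-balaban desk reading of the ×2 renders, pub-ymgap INBOX 2026-08-27): *"Finally, we
have the inequalities in L²-norms ‖hG′(U)λ‖, ‖h∇_UG′(U)λ‖, ‖hG′(U)∇\*_Uλ‖, ‖h∇_U∇_UG′(U)λ‖, ‖h∇_UG′(U)∇\*_Uλ‖, ‖hG′(U)∇\*_U∇\*_Uλ‖ ≦
B₀[(Lʲη)², Lʲη, Lʲη, 1, 1, 1]|h|e^{−δ₀d(y,y′)}‖λ‖ for supp h ⊂ Δ(y), y ∈ Λ_j, supp λ ⊂ Δ(y′)"*; p. 398 ll. 28–31: *"At first the choice of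
derivatives ∇_U, ∇\*_U is conventional … Next, the choice of powers Lʲη is conventional also. Using Lemma 2.1 in [4] we may replace the
factor (Lʲη)^α by (Lʲη)^β(L^{j′}η)^γ with β + γ = α"*; (3.43)–(3.45) p. 398 *"for … ζ ∈ C₀^∞(Δ̃(y))"*; (3.39) p. 397 *"|∇A| = max_{μ,ν} sup
|(D_μA_ν)(x)|"*; Theorem 3.3 p. 399; (3.130)–(3.131) pp. 421–422; p. 422: *"This inequality [(3.131)] and Theorem 3.3 for G₀ imply a
convergence of the series (3.130), for α₀ sufficiently small, in all norms appearing on the left-hand sides of the inequalities (3.42)–(3.47),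
except the inequality involving the Laplace operator in (3.42)"*; Theorem 3.12 p. 423; [4] (2.51)–(2.52) p. 232, Lemma 2.1 p. 234.

WHY THIS FILE (successor of `…B9Thm312WholeBlocksRel`, same seat).  That file derives the two typed blocks through the co-reading schemas
`B9RWSumsReadsRel.L2ReadsRel` ∕ `H1ReadsRel` ∕ `InputReadsRel`, whose observation is sited on the CLASS of y; at the record geometry
(`geo9Y x = geo9K x.toKIdx`) the cut-off predicates `cutIn = cutInT` are the Δ̃-reading and the coordinate evaluation over-counts the
fibre-L² size, so those schemas are NOT dischargeable there (n06-k's located obstructions (O1)∕(O2), kernel negative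
`B9RWSumsReadsRelNegative.not_l2ReadsRel_evBK`) and a leaf carrying them knits vacuously in those binders.  THIS FILE re-derives both blocks
in the NEIGHBOURHOOD-SITED species `B9RWSumsReadsNbr.L2ReadsNbr` ∕ `H1ReadsNbr` ∕ `InputReadsNbr` (support side still relative to `Rel`,
observation radius r, evaluation constant Cev; the dischargeable species of record, `B9CoReadingCoordsL2.l2ReadsNbr_kernelFamilyB_coords_*`),
and re-models the two second-order L² lines print-faithfully:
* §1 reading level (generic): ★ `l2Block_of_blockBds_nbr` — six block-L² bounds of printed shape (lines 3∕5 between the G-lattice X and an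
  ARBITRARY output lattice X₃ with block map `blk₃`, where the packaged pair families live) + six `L2ReadsNbr` ⇒
  `L2Block K (mN·m·Cev·CL²·e^{rδ}·K_L) δ U`; ★ `ineq343_345_of_majorants_nbr` — the two probe majorants + the two input-class majorants +
  `H1ReadsNbr` + `InputReadsNbr` ⇒ `B9.Ineq343_345 K (m·CL·e^{rδ}·B_h) (e^{rδ}·K₄₄) (CL·e^{rδ}·K₄₅) δ U`.
* §2 the second-order lines at the operator level, GENERIC LETTERS: ★ `l2bd_left_of_step` — for any left letter E : 𝔩(X) → 𝔩(X₃) with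
  Theorem 3.3's block bound of E∘G₀ in r1's ratio class, the block bound of E∘A (A = G₀ + G₀TA) by `B9SectDL2Decay.thm312_entry_l2` and the
  p. 398 transfer ([4] (2.60)); ★ `l2bd_right_of_step` — the same for A∘F, F : 𝔩(X₀) → 𝔩(X); then the DIRECTION-PAIR letters
  `Dd Dds : B.Cfg → P → Module.End ℝ (X → ℝ)` (∇_{U,μ}, ∇\*_{U,μ} in a fixed direction μ ∈ P as operators on X), the schema ★ `Thm33G0L2P`
  (Theorem 3.3 (3.46) for G₀ in r1's classes with the lines 3∕5 PER PAIR (ν, μ)), and ★ `l2bd_family3_of_step` ∕ ★ `l2bd_family5_of_step` —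
  the families ∇_ν∇_μA, A∇\*_ν∇\*_μ packaged by n06-k's `B9RWSums346SecondDiff.familyOp` over P × P as ONE model X → X × (P × P) with
  block map `blk ∘ Prod.fst` (constant √|P × P|, `blockBd_familyOp`) — the shape of n06-k's `allIneqs_of_majorants_pair` binders `hb3 hb5 hl3 hl5`.
* §3 ONE MEMBER, ONE U, ONE PROPAGATOR A (with (Δ_a − T)A = I): def `constL2N`, ★ `l2Block_of_step_nbr` and ★ `holder_of_step_nbr` — the Nbr
  twins of `…BlocksRel.l2Block_of_step` ∕ `holder_of_step` (lines 0, 1, 2 by Schur from the PROVED sup majorants, line 4 by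
  `…L2.l2bd_entry4_of_step`, lines 3∕5 by §2, (3.43)–(3.45) by `…Holder.probe43L∕43R∕input44∕45_of_step`), under the extra geometric
  binders of the Nbr engines: neighbourhood count `(nbr g r y).card ≤ mN`, level comparability `d(a,a′) ≤ r ⇒ Lʲ⁽ᵃ⁾η ≤ CL·Lʲ⁽ᵃ′⁾η` (1 ≦ CL),
  0 ≦ r, 0 ≦ Cev (the triangle inequality and the symmetry of d come from `GeoOK`).

HONEST SCOPE.  Nothing of [B9] or [4] is asserted: every schema, letter, reading and member fact is a HYPOTHESIS of printed ∕ definitional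
shape; the content is print's one-sentence argument (p. 422) carried out class by class, kernel-checked.  NOT a node discharge, NOT summit
progress; one finite lattice at a time; nothing continuum, nothing about the mass gap.  Cell `pub-ymgap` (HUMAN RULING D-0062), Track A
node N06 [B9], N06-ASSIGNMENT v1 rows 20–21 (bundle F7), seat `pub-ymgap-dag-n06-l` (g5), 2026-08-27.
-/

namespace Literature.MathematicalPhysics.QuantumFieldTheory.Balaban1983to89.B9Thm312WholeBlocksNbr

open Literature.MathematicalPhysics.QuantumFieldTheory.Balaban1983to89
open Finset B6RandomWalk B6RandomWalkHom B9Thm34Ext B9Thm37Glue B9Thm37GlueCor36 B11SectG B9SectDSup B9SectDL2Decay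
open B9Thm37AllNorms B9Thm37AllNormsInstances B9FromB6 B9FromB6ModelSignsOn B9SectBStepWhole B9Thm312Whole B9Thm312WholeLeaf
open B9Thm312WholeLeft B9RWSums343Holder B9RWSums346Schur B9RWSumsReadsRel B9RWSumsReadsNbr B9Ineq347 B9Thm312WholeClasses
open B9Thm312WholeHolder B9Thm312WholeL2 B9Thm312WholeBlocksRel B9RWSums346SecondDiff

noncomputable section

/-! ## §1 Reading level: the two typed blocks from operator-level majorants and neighbourhood-sited co-readings -/

section Reading

variable {g : B9.Geometry} [Fintype g.Site] [DecidableEq g.Site] {R : ℝ} {H : Prop} {B : B9.Backgrounds}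
variable {X Y X₃ PX PY : Type} [Fintype X] [Fintype Y] [Fintype X₃] [Fintype PX] [Fintype PY]

omit [Fintype PX] [Fintype PY] in
/-- ★ **THE L² BLOCK (3.46) OF A CO-READ KERNEL FAMILY from six block-L² bounds of printed shape**, neighbourhood reading: if the model
operators A₀, A₁, A₂, A₄ (types of A, ∇_UA, A∇\*_U, ∇_UA∇\*_U) and A₃, A₅ (the packaged pair families ∇∇A, A∇\*∇\*, from X into an output lattice X₃
with block map `blk₃`) have the block bounds K_L·pref6(Lʲη)ₙ·e^{−δd(y,y′)} (K_L ≧ 0, 0 ≦ δ), `K.l2 n` is co-read by Aₙ on the neighbourhood of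
radius r ≧ 0 (n06-k `L2ReadsNbr`, support side relative to `Rel` with class count ≦ m and d saturated in its second argument; neighbourhood
count ≦ mN, level comparability CL, evaluation constant Cev ≧ 0), then `L2Block K (mN·m·Cev·CL²·e^{rδ}·K_L) δ U` (n06-k's
`l2line_of_blockBd_nbr`, line by line). [cite: Balaban1985BackgroundPropagators, (3.46) p.398 + p.397 (Δ̃); Balaban1984PropagatorsII, (2.51)–(2.52) p.232] -/
theorem l2Block_of_blockBds_nbr (hG : GeoOK g) {K : B9.KernelFamily g B} {U : B.Cfg} {Rel : g.Site → g.Site → Prop} [DecidableRel Rel]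
    {r Cev : ℝ} {blk : X → g.Site} {blkY : Y → g.Site} {blk₃ : X₃ → g.Site} {ev : g.Loc → X → ℝ} {evY : g.Loc → Y → ℝ}
    {A0 : Module.End ℝ (X → ℝ)} {A1 : (X → ℝ) →ₗ[ℝ] (Y → ℝ)} {A2 : (Y → ℝ) →ₗ[ℝ] (X → ℝ)} {A4 : Module.End ℝ (Y → ℝ)}
    {A3 A5 : (X → ℝ) →ₗ[ℝ] (X₃ → ℝ)}
    (hRd₂ : ∀ a b b', Rel b b' → g.dist a b = g.dist a b')
    {m : ℕ} (hmult : ∀ y' : g.Site, (Finset.univ.filter (fun y'' => Rel y'' y')).card ≤ m)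
    {mN : ℕ} (hnbr : ∀ y : g.Site, (nbr g r y).card ≤ mN)
    {CL : ℝ} (hCL1 : 1 ≤ CL) (hCL : ∀ a a' : g.Site, g.dist a a' ≤ r → g.len a ≤ CL * g.len a') (hCev : 0 ≤ Cev)
    {KL δ : ℝ} (hKL : 0 ≤ KL) (hδ : 0 ≤ δ)
    (hb0 : BlockBd (g := toB6 g R H) blk blk A0 (fun (y y' : g.Site) => KL * B9.pref6 (g.len y) 0 * Real.exp (-(δ * g.dist y y'))))
    (hb1 : BlockBd (g := toB6 g R H) blk blkY A1 (fun (y y' : g.Site) => KL * B9.pref6 (g.len y) 1 * Real.exp (-(δ * g.dist y y'))))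
    (hb2 : BlockBd (g := toB6 g R H) blkY blk A2 (fun (y y' : g.Site) => KL * B9.pref6 (g.len y) 2 * Real.exp (-(δ * g.dist y y'))))
    (hb3 : BlockBd (g := toB6 g R H) blk blk₃ A3 (fun (y y' : g.Site) => KL * B9.pref6 (g.len y) 3 * Real.exp (-(δ * g.dist y y'))))
    (hb4 : BlockBd (g := toB6 g R H) blkY blkY A4 (fun (y y' : g.Site) => KL * B9.pref6 (g.len y) 4 * Real.exp (-(δ * g.dist y y'))))
    (hb5 : BlockBd (g := toB6 g R H) blk blk₃ A5 (fun (y y' : g.Site) => KL * B9.pref6 (g.len y) 5 * Real.exp (-(δ * g.dist y y'))))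
    (hl0 : L2ReadsNbr (R := R) (H := H) K 0 U Rel r Cev blk blk ev A0)
    (hl1 : L2ReadsNbr (R := R) (H := H) K 1 U Rel r Cev blkY blk ev A1)
    (hl2 : L2ReadsNbr (R := R) (H := H) K 2 U Rel r Cev blk blkY evY A2)
    (hl3 : L2ReadsNbr (R := R) (H := H) K 3 U Rel r Cev blk₃ blk ev A3)
    (hl4 : L2ReadsNbr (R := R) (H := H) K 4 U Rel r Cev blkY blkY evY A4)
    (hl5 : L2ReadsNbr (R := R) (H := H) K 5 U Rel r Cev blk₃ blk ev A5) :
    L2Block K (mN * m * Cev * CL ^ 2 * Real.exp (r * δ) * KL) δ U := by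
  intro n
  fin_cases n
  · exact l2line_of_blockBd_nbr hl0 hRd₂ hmult hnbr hCL1 hCL hG.tri hG.symm hKL hδ hCev hG.lenle hb0
  · exact l2line_of_blockBd_nbr hl1 hRd₂ hmult hnbr hCL1 hCL hG.tri hG.symm hKL hδ hCev hG.lenle hb1
  · exact l2line_of_blockBd_nbr hl2 hRd₂ hmult hnbr hCL1 hCL hG.tri hG.symm hKL hδ hCev hG.lenle hb2
  · exact l2line_of_blockBd_nbr hl3 hRd₂ hmult hnbr hCL1 hCL hG.tri hG.symm hKL hδ hCev hG.lenle hb3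
  · exact l2line_of_blockBd_nbr hl4 hRd₂ hmult hnbr hCL1 hCL hG.tri hG.symm hKL hδ hCev hG.lenle hb4
  · exact l2line_of_blockBd_nbr hl5 hRd₂ hmult hnbr hCL1 hCL hG.tri hG.symm hKL hδ hCev hG.lenle hb5

omit [Fintype X] [Fintype X₃] [Fintype PX] in
/-- ★ **THE HÖLDER BLOCK (3.43)–(3.45) OF A CO-READ KERNEL FAMILY from the four operator-level majorants**, neighbourhood reading: the two
probe majorants B_h(β)(Lʲη)^{1−β}e^{−δd} of Φ^Y_β∘A₁ and Φ^X_β∘A₂ ((3.43), `H1ReadsNbr`: probes within distance r of y), the input-class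
majorants K₄₄(ε)e^{−δd} of A₄ and K₄₅(ε,β)(Lʲη)^{−β}e^{−δd} of Φ^Y_β∘A₄ ((3.44)–(3.45), `InputReadsNbr`) ⇒
`B9.Ineq343_345 K (m·CL·e^{rδ}·B_h) (e^{rδ}·K₄₄) (CL·e^{rδ}·K₄₅) δ U` (n06-k's `line343_of_hasMajorantHom_nbr` and `lines3445_of_hasMaj_nbr`).
[cite: Balaban1985BackgroundPropagators, (3.43)–(3.45) p.398 + (3.40) p.397; Balaban1984PropagatorsII, (2.51)–(2.52) p.232] -/
theorem ineq343_345_of_majorants_nbr (hG : GeoOK g) {K : B9.KernelFamily g B} {U : B.Cfg} (𝔭 : HolderProbes g B X Y PX PY)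
    (bH : ℝ → BlockNorm (toB6 g R H) (Y → ℝ)) {Rel : g.Site → g.Site → Prop} [DecidableRel Rel] {r : ℝ}
    {blk : X → g.Site} {blkY : Y → g.Site} {ev : g.Loc → X → ℝ} {evY : g.Loc → Y → ℝ}
    {A1 : (X → ℝ) →ₗ[ℝ] (Y → ℝ)} {A2 : (Y → ℝ) →ₗ[ℝ] (X → ℝ)} {A4 : Module.End ℝ (Y → ℝ)}
    (hRd₂ : ∀ a b b', Rel b b' → g.dist a b = g.dist a b')
    {m : ℕ} (hmult : ∀ y' : g.Site, (Finset.univ.filter (fun y'' => Rel y'' y')).card ≤ m)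
    {CL : ℝ} (hCL1 : 1 ≤ CL) (hCL : ∀ a a' : g.Site, g.dist a a' ≤ r → g.len a ≤ CL * g.len a')
    {Bh K44 : ℝ → ℝ} {K45 : ℝ → ℝ → ℝ} {δ : ℝ} (hBh : ∀ β, 0 ≤ β → β < 1 → 0 ≤ Bh β)
    (hK44 : ∀ ε, 0 < ε → ε ≤ 1 → 0 ≤ K44 ε) (hK45 : ∀ ε β, 0 < ε → ε ≤ 1 → 0 ≤ β → β < 1 → 0 ≤ K45 ε β) (hδ : 0 ≤ δ)
    (hL : ∀ β, 0 ≤ β → β < 1 → HasMajorantHom (g := toB6 g R H) blk 𝔭.blkPY (𝔭.ΦY U β ∘ₗ A1)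
      (fun (a b : g.Site) => Bh β * g.len a ^ (1 - β) * Real.exp (-(δ * g.dist a b))))
    (hRt : ∀ β, 0 ≤ β → β < 1 → HasMajorantHom (g := toB6 g R H) blkY 𝔭.blkPX (𝔭.ΦX U β ∘ₗ A2)
      (fun (a b : g.Site) => Bh β * g.len a ^ (1 - β) * Real.exp (-(δ * g.dist a b))))
    (h44 : ∀ ε, 0 < ε → ε ≤ 1 → HasMaj (bH ε) (BlockNorm.ofBlocks (toB6 g R H) blkY) A4
      (fun (a b : g.Site) => K44 ε * Real.exp (-(δ * g.dist a b))))
    (h45 : ∀ ε β, 0 < ε → ε ≤ 1 → 0 ≤ β → β < 1 →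
      HasMaj (bH (β + ε)) (BlockNorm.ofBlocks (toB6 g R H) 𝔭.blkPY) (𝔭.ΦY U β ∘ₗ A4)
        (fun (a b : g.Site) => K45 ε β * g.len a ^ (-β) * Real.exp (-(δ * g.dist a b))))
    (hH1 : H1ReadsNbr K U 𝔭 Rel r blk blkY ev evY A1 A2) (hIR : InputReadsNbr K U 𝔭 bH r blkY evY A4) :
    B9.Ineq343_345 K (fun β => m * CL * Real.exp (r * δ) * Bh β) (fun ε => Real.exp (r * δ) * K44 ε)
      (fun ε β => CL * Real.exp (r * δ) * K45 ε β) δ U := by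
  have h343 := line343_of_hasMajorantHom_nbr (R := R) (H := H) hH1 hRd₂ hmult hCL1 hCL hG.tri hG.symm hBh hδ hG.lenle hL hRt
  have h3445 := lines3445_of_hasMaj_nbr (R := R) (H := H) hIR hCL1 hCL hG.tri hG.symm hK44 hK45 hδ hG.lenpos h44 h45
  exact ⟨h343, h3445.1, h3445.2⟩

end Reading

/-! ## §2 The second-order L² lines with generic letters, and the direction-pair families packaged by `familyOp` -/

section Second

variable {g : B9.Geometry} {B : B9.Backgrounds} {X Y Z W P : Type} [Fintype X] [Fintype Y] [Fintype g.Site]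
variable {R₀ : ℝ} {H₀ : Prop}

omit [Fintype Y] in
/-- ★ **A SECOND-ORDER L² LINE WITH A GENERIC LEFT LETTER** — for E : 𝔩(X) → 𝔩(X₃) (∇_ν∇_μ, Δ_U, …) the block bound of E∘A, A ∈ {G, G₁}:
r1-g6's Neumann bookkeeping `B9SectDL2Decay.thm312_entry_l2` (E∘A = E∘G₀ + (E∘G₀)T′A, A = G₀ + (G₀T′)A) in the classes W₀ = W₁ = W₁′ = W₃ = Lʲη,
W₂ = (Lʲη)⁻¹ from Theorem 3.3's block bounds of G₀ ((3.46)₀ symmetrised, `hl0`) and of E∘G₀ ((3.46)₃-type with the ratio L^{j′}η∕Lʲη, `hE`) and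
the step's bound (`hT`), which yields the bound with the ratio L^{j′}η∕Lʲη, then the scale transfer of p. 398 (`…L2.blockBd_transfer`, [4]
(2.60) at (ρ₀, α), constant Λ): block bound (B₂ + B₂θB₂(1 − B₂θc²)⁻¹c²)·Λ·e^{−(ρ−αρ₀)d(y,y′)} (the abstraction of `…L2.l2bd_entry3_of_step` from
Δ_U to any E). [cite: Balaban1985BackgroundPropagators, Thm 3.12 p.423 + (3.46) p.398 + (3.130) p.421 + p.398; Balaban1984PropagatorsII, Lemma 2.1 p.234] -/
theorem l2bd_left_of_step (hG : GeoOK g) {X₃ : Type} [Fintype X₃] {blk : X → g.Site} {blk₃ : X₃ → g.Site} {E : (X → ℝ) →ₗ[ℝ] (X₃ → ℝ)}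
    {G0 T A : Module.End ℝ (X → ℝ)} {B₂ θ δ₁ ρ ρ₀ α Λ σ c : ℝ} (hrow : RowSum (toB6 g R₀ H₀) σ c)
    (hB₂ : 0 ≤ B₂) (hθ : 0 ≤ θ) (hρ : 0 ≤ ρ) (hσ : 0 ≤ σ) (hρδ : ρ + 2 * σ ≤ δ₁)
    (hST : ScaleTransfer g ρ₀ α Λ (fun y => g.len y ^ (1 : ℝ)))
    (hl0 : BlockBd (g := toB6 g R₀ H₀) blk blk G0 (fun (y y' : g.Site) => B₂ * g.len y * g.len y' * Real.exp (-(δ₁ * g.dist y y'))))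
    (hE : BlockBd (g := toB6 g R₀ H₀) blk blk₃ (E ∘ₗ G0)
      (fun (y y' : g.Site) => B₂ * ((g.len y)⁻¹ * g.len y') * Real.exp (-(δ₁ * g.dist y y'))))
    (hT : BlockBd (g := toB6 g R₀ H₀) blk blk T
      (fun (y y' : g.Site) => θ * (g.len y)⁻¹ * (g.len y')⁻¹ * Real.exp (-(δ₁ * g.dist y y'))))
    (hfix : A = G0 + G0 ∘ₗ T ∘ₗ A) (hq : B₂ * θ * c * c < 1) :
    BlockBd (g := toB6 g R₀ H₀) blk blk₃ (E ∘ₗ A)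
      (fun (y y' : g.Site) => (B₂ + B₂ * (θ * (B₂ * (1 - B₂ * θ * c * c)⁻¹) * c) * c) * Λ *
        Real.exp (-((ρ - α * ρ₀) * g.dist y y'))) := by
  -- adapted from `B9Thm312WholeL2.l2bd_entry3_of_step` (Δ_U ↦ E)
  have htri : Triangle254 (toB6 g R₀ H₀) := fun a b c => hG.tri a b c
  have hWl : ∀ y : g.Site, 0 < g.len y := hG.lenpos
  have hWi : ∀ y : g.Site, 0 < (g.len y)⁻¹ := fun y => inv_pos.mpr (hG.lenpos y)
  have hq1 : 0 ≤ (1 - B₂ * θ * c * c)⁻¹ := inv_nonneg.mpr (by linarith)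
  have hc : 0 ≤ c ∨ IsEmpty g.Site := by
    by_cases hne : Nonempty g.Site
    · exact Or.inl (hrow.nonneg hne.some)
    · exact Or.inr (not_nonempty_iff.mp hne)
  rcases hc with hc | hemp
  swap
  · intro y' μ hμ y
    exact (hemp.false y).elim
  have hK0 : 0 ≤ B₂ + B₂ * (θ * (B₂ * (1 - B₂ * θ * c * c)⁻¹) * c) * c :=
    add_nonneg hB₂ (mul_nonneg (mul_nonneg hB₂ (mul_nonneg (mul_nonneg hθ (mul_nonneg hB₂ hq1)) hc)) hc)
  have hl0' : BlockBd (g := toB6 g R₀ H₀) blk blk (G0 ∘ₗ LinearMap.id)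
      (fun (y y' : g.Site) => ((g.len y)⁻¹)⁻¹ * g.len y' * (B₂ * Real.exp (-(δ₁ * (toB6 g R₀ H₀).dist y y')))) := by
    rw [LinearMap.comp_id]
    exact hl0.mono fun y y' => le_of_eq (by simp only [inv_inv, toB6_dist]; ring)
  have hE' : BlockBd (g := toB6 g R₀ H₀) blk blk₃ (E ∘ₗ G0 ∘ₗ LinearMap.id)
      (fun (y y' : g.Site) => (g.len y)⁻¹ * g.len y' * (B₂ * Real.exp (-(δ₁ * (toB6 g R₀ H₀).dist y y')))) := by
    rw [LinearMap.comp_id]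
    exact hE.mono fun y y' => le_of_eq (by simp only [toB6_dist]; ring)
  have h := thm312_entry_l2 (g := toB6 g R₀ H₀) (blk₀ := blk) (blk := blk) (blk₃ := blk₃)
    (W₀ := fun y => g.len y) (W₁ := fun y => g.len y) (W₂ := fun y => (g.len y)⁻¹) (W₁' := fun y => g.len y)
    (W₃ := fun y => g.len y) (G := A) (G0 := G0) (T' := T) (Eop := E) (Fop := LinearMap.id)
    (B := B₂) (θ := θ) (A := B₂) (θ' := θ) (BE := B₂) (AEF := B₂) hWl hWl hWi hWl hWl htri hG.dnn hrow hB₂ hθ hB₂ hθ hB₂ hB₂ hρ hσ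
    hρδ
    (hl0.mono fun y y' => le_of_eq (by simp only [inv_inv, toB6_dist]; ring))
    (hT.mono fun y y' => le_of_eq (by simp only [toB6_dist]; ring))
    hl0'
    (hT.mono fun y y' => le_of_eq (by simp only [toB6_dist]; ring))
    (hE.mono fun y y' => le_of_eq (by simp only [toB6_dist]; ring))
    hE' (fix_mul_of_fix hfix) hq
  rw [LinearMap.comp_id] at h
  have h' : BlockBd (g := toB6 g R₀ H₀) blk blk₃ (E ∘ₗ A)
      (fun (y y' : g.Site) => (B₂ + B₂ * (θ * (B₂ * (1 - B₂ * θ * c * c)⁻¹) * c) * c) *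
        (g.len y' ^ (1 : ℝ) * (g.len y ^ (1 : ℝ))⁻¹) * Real.exp (-(ρ * g.dist y y'))) :=
    h.mono fun y y' => le_of_eq (by simp only [toB6_dist, Real.rpow_one]; ring)
  exact blockBd_transfer (C := fun _ _ => B₂ + B₂ * (θ * (B₂ * (1 - B₂ * θ * c * c)⁻¹) * c) * c) (fun _ _ => hK0)
    (fun z => Real.rpow_pos_of_pos (hG.lenpos z) 1) hST h'

omit [Fintype Y] in
/-- ★ **A SECOND-ORDER L² LINE WITH A GENERIC RIGHT LETTER** — for F : 𝔩(X₀) → 𝔩(X) (∇\*_ν∇\*_μ, Δ_U, …) the block bound of A∘F: `thm312_entry_l2`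
with the left letter I and the right letter F in the classes W₀ = (Lʲη)⁻¹, W₁ = W₁′ = Lʲη, W₂ = W₃ = (Lʲη)⁻¹ (from (3.46)₀ and the (3.46)₅-type
bound of G₀∘F with the ratio Lʲη∕L^{j′}η, `hF`), then the scale transfer at γ = −1 (constant Λ′): block bound
(B₂ + B₂θB₂(1 − B₂θc²)⁻¹c²)·Λ′·e^{−(ρ−αρ₀)d} (the abstraction of `…L2.l2bd_entry5_of_step` from Δ_U to any F).
[cite: Balaban1985BackgroundPropagators, Thm 3.12 p.423 + (3.46) p.398 + (3.130) p.421 + p.398; Balaban1984PropagatorsII, Lemma 2.1 p.234] -/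
theorem l2bd_right_of_step (hG : GeoOK g) {X₀ : Type} [Fintype X₀] {blk : X → g.Site} {blk₀ : X₀ → g.Site} {F : (X₀ → ℝ) →ₗ[ℝ] (X → ℝ)}
    {G0 T A : Module.End ℝ (X → ℝ)} {B₂ θ δ₁ ρ ρ₀ α Λ σ c : ℝ} (hrow : RowSum (toB6 g R₀ H₀) σ c)
    (hB₂ : 0 ≤ B₂) (hθ : 0 ≤ θ) (hρ : 0 ≤ ρ) (hσ : 0 ≤ σ) (hρδ : ρ + 2 * σ ≤ δ₁)
    (hST : ScaleTransfer g ρ₀ α Λ (fun y => g.len y ^ (-1 : ℝ)))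
    (hl0 : BlockBd (g := toB6 g R₀ H₀) blk blk G0 (fun (y y' : g.Site) => B₂ * g.len y * g.len y' * Real.exp (-(δ₁ * g.dist y y'))))
    (hF : BlockBd (g := toB6 g R₀ H₀) blk₀ blk (G0 ∘ₗ F)
      (fun (y y' : g.Site) => B₂ * (g.len y * (g.len y')⁻¹) * Real.exp (-(δ₁ * g.dist y y'))))
    (hT : BlockBd (g := toB6 g R₀ H₀) blk blk T
      (fun (y y' : g.Site) => θ * (g.len y)⁻¹ * (g.len y')⁻¹ * Real.exp (-(δ₁ * g.dist y y'))))
    (hfix : A = G0 + G0 ∘ₗ T ∘ₗ A) (hq : B₂ * θ * c * c < 1) :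
    BlockBd (g := toB6 g R₀ H₀) blk₀ blk (A ∘ₗ F)
      (fun (y y' : g.Site) => (B₂ + B₂ * (θ * (B₂ * (1 - B₂ * θ * c * c)⁻¹) * c) * c) * Λ *
        Real.exp (-((ρ - α * ρ₀) * g.dist y y'))) := by
  -- adapted from `B9Thm312WholeL2.l2bd_entry5_of_step` (Δ_U ↦ F)
  have htri : Triangle254 (toB6 g R₀ H₀) := fun a b c => hG.tri a b c
  have hWl : ∀ y : g.Site, 0 < g.len y := hG.lenpos
  have hWi : ∀ y : g.Site, 0 < (g.len y)⁻¹ := fun y => inv_pos.mpr (hG.lenpos y)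
  have hq1 : 0 ≤ (1 - B₂ * θ * c * c)⁻¹ := inv_nonneg.mpr (by linarith)
  have hc : 0 ≤ c ∨ IsEmpty g.Site := by
    by_cases hne' : Nonempty g.Site
    · exact Or.inl (hrow.nonneg hne'.some)
    · exact Or.inr (not_nonempty_iff.mp hne')
  rcases hc with hc | hemp
  swap
  · intro y' μ hμ y
    exact (hemp.false y).elim
  have hK0 : 0 ≤ B₂ + B₂ * (θ * (B₂ * (1 - B₂ * θ * c * c)⁻¹) * c) * c :=
    add_nonneg hB₂ (mul_nonneg (mul_nonneg hB₂ (mul_nonneg (mul_nonneg hθ (mul_nonneg hB₂ hq1)) hc)) hc)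
  have hE' : BlockBd (g := toB6 g R₀ H₀) blk blk (LinearMap.id ∘ₗ G0)
      (fun (y y' : g.Site) => ((g.len y)⁻¹)⁻¹ * g.len y' * (B₂ * Real.exp (-(δ₁ * (toB6 g R₀ H₀).dist y y')))) := by
    rw [LinearMap.id_comp]
    exact hl0.mono fun y y' => le_of_eq (by simp only [inv_inv, toB6_dist]; ring)
  have hEF' : BlockBd (g := toB6 g R₀ H₀) blk₀ blk (LinearMap.id ∘ₗ G0 ∘ₗ F)
      (fun (y y' : g.Site) => ((g.len y)⁻¹)⁻¹ * (g.len y')⁻¹ * (B₂ * Real.exp (-(δ₁ * (toB6 g R₀ H₀).dist y y')))) := by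
    rw [LinearMap.id_comp]
    exact hF.mono fun y y' => le_of_eq (by simp only [inv_inv, toB6_dist]; ring)
  have h := thm312_entry_l2 (g := toB6 g R₀ H₀) (blk₀ := blk₀) (blk := blk) (blk₃ := blk)
    (W₀ := fun y => (g.len y)⁻¹) (W₁ := fun y => g.len y) (W₂ := fun y => (g.len y)⁻¹) (W₁' := fun y => g.len y)
    (W₃ := fun y => (g.len y)⁻¹) (G := A) (G0 := G0) (T' := T) (Eop := LinearMap.id) (Fop := F)
    (B := B₂) (θ := θ) (A := B₂) (θ' := θ) (BE := B₂) (AEF := B₂) hWi hWl hWi hWl hWi htri hG.dnn hrow hB₂ hθ hB₂ hθ hB₂ hB₂ hρ hσ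
    hρδ
    (hl0.mono fun y y' => le_of_eq (by simp only [inv_inv, toB6_dist]; ring))
    (hT.mono fun y y' => le_of_eq (by simp only [toB6_dist]; ring))
    (hF.mono fun y y' => le_of_eq (by simp only [inv_inv, toB6_dist]; ring))
    (hT.mono fun y y' => le_of_eq (by simp only [toB6_dist]; ring))
    hE' hEF' (fix_mul_of_fix hfix) hq
  rw [LinearMap.id_comp] at h
  have h' : BlockBd (g := toB6 g R₀ H₀) blk₀ blk (A ∘ₗ F)
      (fun (y y' : g.Site) => (B₂ + B₂ * (θ * (B₂ * (1 - B₂ * θ * c * c)⁻¹) * c) * c) *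
        (g.len y' ^ (-1 : ℝ) * (g.len y ^ (-1 : ℝ))⁻¹) * Real.exp (-(ρ * g.dist y y'))) := by
    refine h.mono fun y y' => le_of_eq ?_
    simp only [toB6_dist, Real.rpow_neg_one, inv_inv]
    ring
  exact blockBd_transfer (C := fun _ _ => B₂ + B₂ * (θ * (B₂ * (1 - B₂ * θ * c * c)⁻¹) * c) * c) (fun _ _ => hK0)
    (fun z => Real.rpow_pos_of_pos (hG.lenpos z) (-1)) hST h'

/-- ★ **THEOREM 3.3, THE L² MEMBERS (3.46), FOR G₀ AT THE CONFIGURATION U AS BLOCK-L² BOUNDS — THE SECOND-ORDER MEMBERS PER DIRECTION PAIR**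
(p. 399: G₀ = G(U) *"satisfies the inequalities (3.42)–(3.47)"*; (3.46) p. 398, printed members ∇_U∇_UG′, G′∇\*_U∇\*_U; (3.39) p. 397 *"max_{μ,ν}"*),
in r1-g6's weight classes exactly as `B9Thm312WholeL2.Thm33G0L2` (whose Laplacian letter this schema replaces by the direction letters
`Dd U μ` = ∇_{U,μ}, `Dds U μ` = ∇\*_{U,μ} as operators on the G-lattice X): `l0`, `l1`, `l2`, `l4` verbatim; `l3 q` — ∇_{U,ν}∇_{U,μ}G₀ with
B·(L^{j′}η∕Lʲη) and `l5 q` — G₀∇\*_{U,ν}∇\*_{U,μ} with B·(Lʲη∕L^{j′}η) for every pair q = (ν, μ) (printed constant 1 times the dimensionless scale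
ratio, p. 398 remark).  A HYPOTHESIS SCHEMA (Theorem 3.3 is the leaf `t33` of the knit, not asserted here).
[cite: Balaban1985BackgroundPropagators, Thm 3.3 p.399 + (3.46) p.398 + (3.39) p.397 + p.398 (remark after (3.47))] -/
structure Thm33G0L2P (𝔬 : Ops g B X Y Z W) (Dd Dds : B.Cfg → P → Module.End ℝ (X → ℝ)) (R₀ : ℝ) (H₀ : Prop) (B₂ δ₁ : ℝ)
    (U : B.Cfg) : Prop where
  l0 : BlockBd (g := toB6 g R₀ H₀) 𝔬.blk 𝔬.blk (𝔬.G0 U)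
    (fun (y y' : g.Site) => B₂ * g.len y * g.len y' * Real.exp (-(δ₁ * g.dist y y')))
  l1 : BlockBd (g := toB6 g R₀ H₀) 𝔬.blk 𝔬.blkY (𝔬.D U ∘ₗ 𝔬.G0 U)
    (fun (y y' : g.Site) => B₂ * g.len y' * Real.exp (-(δ₁ * g.dist y y')))
  l2 : BlockBd (g := toB6 g R₀ H₀) 𝔬.blkY 𝔬.blk (𝔬.G0 U ∘ₗ 𝔬.Dstar U)
    (fun (y y' : g.Site) => B₂ * g.len y * Real.exp (-(δ₁ * g.dist y y')))
  l3 : ∀ q : P × P, BlockBd (g := toB6 g R₀ H₀) 𝔬.blk 𝔬.blk ((Dd U q.1 ∘ₗ Dd U q.2) ∘ₗ 𝔬.G0 U)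
    (fun (y y' : g.Site) => B₂ * ((g.len y)⁻¹ * g.len y') * Real.exp (-(δ₁ * g.dist y y')))
  l4 : BlockBd (g := toB6 g R₀ H₀) 𝔬.blkY 𝔬.blkY (𝔬.D U ∘ₗ (𝔬.G0 U ∘ₗ 𝔬.Dstar U))
    (fun (y y' : g.Site) => B₂ * Real.exp (-(δ₁ * g.dist y y')))
  l5 : ∀ q : P × P, BlockBd (g := toB6 g R₀ H₀) 𝔬.blk 𝔬.blk (𝔬.G0 U ∘ₗ (Dds U q.1 ∘ₗ Dds U q.2))
    (fun (y y' : g.Site) => B₂ * (g.len y * (g.len y')⁻¹) * Real.exp (-(δ₁ * g.dist y y')))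

/-- The pair schema yields the Laplacian-letter schema `Thm33G0L2` for ANY letter whose bounds it does not use: its `l0 l1 l2 l4` fields
(the sequel needs `Thm33G0L2 … l4` only through `…L2.l2bd_entry4_of_step`, which reads `l0 l1 l2 l4`) — here with the letter
∇_{U,ν}∇_{U,μ} ⊕ … replaced by the ZERO letter, whose lines 3 and 5 hold trivially. [cite: Balaban1985BackgroundPropagators, (3.46) p.398 (bookkeeping)] -/
theorem Thm33G0L2P.toLap {𝔬 : Ops g B X Y Z W} {Dd Dds : B.Cfg → P → Module.End ℝ (X → ℝ)} {B₂ δ₁ : ℝ} {U : B.Cfg}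
    (hB₂ : 0 ≤ B₂) (hlen : ∀ y : g.Site, 0 ≤ g.len y) (h : Thm33G0L2P 𝔬 Dd Dds R₀ H₀ B₂ δ₁ U) :
    Thm33G0L2 𝔬 (fun _ => (0 : Module.End ℝ (X → ℝ))) R₀ H₀ B₂ δ₁ U := by
  have hz : ∀ (K : g.Site → g.Site → ℝ), (∀ a b, 0 ≤ K a b) →
      BlockBd (g := toB6 g R₀ H₀) 𝔬.blk 𝔬.blk (0 : Module.End ℝ (X → ℝ)) K := by
    intro K hK y' μ _ y
    rw [LinearMap.zero_apply, bl2_zero]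
    exact mul_nonneg (hK y y') (bl2_nonneg _ _ _)
  refine { l0 := h.l0, l1 := h.l1, l2 := h.l2, l4 := h.l4, l3 := ?_, l5 := ?_ }
  · rw [LinearMap.zero_comp]
    exact hz _ fun a b => mul_nonneg (mul_nonneg hB₂ (mul_nonneg (inv_nonneg.mpr (hlen a)) (hlen b))) (Real.exp_nonneg _)
  · rw [LinearMap.comp_zero]
    exact hz _ fun a b => mul_nonneg (mul_nonneg hB₂ (mul_nonneg (hlen a) (inv_nonneg.mpr (hlen b)))) (Real.exp_nonneg _)

/-- ★ **(3.46)₃ FOR A ∈ {G, G₁} AS THE PACKAGED PAIR FAMILY ∇_{U,ν}∇_{U,μ}A** — one model X → X × (P × P) with block map `blk ∘ Prod.fst` (n06-k's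
`familyOp`), block bound √|P × P|·(B₂ + B₂θB₂(1 − B₂θc²)⁻¹c²)·Λ·e^{−(ρ−αρ₀)d(y,y′)}: `l2bd_left_of_step` for every pair from `Thm33G0L2P.l3 q`, then
`blockBd_familyOp`. [cite: Balaban1985BackgroundPropagators, Thm 3.12 p.423 + (3.46) p.398 + (3.39) p.397; Balaban1984PropagatorsII, Lemma 2.1 p.234] -/
theorem l2bd_family3_of_step [Fintype P] (hG : GeoOK g) {𝔬 : Ops g B X Y Z W} {Dd Dds : B.Cfg → P → Module.End ℝ (X → ℝ)} {U : B.Cfg}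
    {T A : Module.End ℝ (X → ℝ)} {B₂ θ δ₁ ρ ρ₀ α Λ σ c : ℝ} (hrow : RowSum (toB6 g R₀ H₀) σ c)
    (hB₂ : 0 ≤ B₂) (hθ : 0 ≤ θ) (hρ : 0 ≤ ρ) (hσ : 0 ≤ σ) (hρδ : ρ + 2 * σ ≤ δ₁) (hΛ : 0 ≤ Λ)
    (hST : ScaleTransfer g ρ₀ α Λ (fun y => g.len y ^ (1 : ℝ)))
    (hL : Thm33G0L2P 𝔬 Dd Dds R₀ H₀ B₂ δ₁ U)
    (hT : BlockBd (g := toB6 g R₀ H₀) 𝔬.blk 𝔬.blk T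
      (fun (y y' : g.Site) => θ * (g.len y)⁻¹ * (g.len y')⁻¹ * Real.exp (-(δ₁ * g.dist y y'))))
    (hfix : A = 𝔬.G0 U + 𝔬.G0 U ∘ₗ T ∘ₗ A) (hq : B₂ * θ * c * c < 1) :
    BlockBd (g := toB6 g R₀ H₀) 𝔬.blk (𝔬.blk ∘ Prod.fst) (familyOp (fun q : P × P => (Dd U q.1 ∘ₗ Dd U q.2) ∘ₗ A))
      (fun (y y' : g.Site) => Real.sqrt (Fintype.card (P × P)) * ((B₂ + B₂ * (θ * (B₂ * (1 - B₂ * θ * c * c)⁻¹) * c) * c) * Λ *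
        Real.exp (-((ρ - α * ρ₀) * g.dist y y')))) := by
  have hc : 0 ≤ c ∨ IsEmpty g.Site := by
    by_cases hne : Nonempty g.Site
    · exact Or.inl (hrow.nonneg hne.some)
    · exact Or.inr (not_nonempty_iff.mp hne)
  rcases hc with hc | hemp
  swap
  · intro y' μ hμ y
    exact (hemp.false y).elim
  have hq1 : 0 ≤ (1 - B₂ * θ * c * c)⁻¹ := inv_nonneg.mpr (by linarith)
  have hK0 : 0 ≤ B₂ + B₂ * (θ * (B₂ * (1 - B₂ * θ * c * c)⁻¹) * c) * c :=
    add_nonneg hB₂ (mul_nonneg (mul_nonneg hB₂ (mul_nonneg (mul_nonneg hθ (mul_nonneg hB₂ hq1)) hc)) hc)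
  exact blockBd_familyOp (R := R₀) (H := H₀) 𝔬.blk 𝔬.blk
    (fun a b => mul_nonneg (mul_nonneg hK0 hΛ) (Real.exp_nonneg _))
    fun q => l2bd_left_of_step hG hrow hB₂ hθ hρ hσ hρδ hST hL.l0 (hL.l3 q) hT hfix hq

/-- ★ **(3.46)₅ FOR A ∈ {G, G₁} AS THE PACKAGED PAIR FAMILY A∇\*_{U,ν}∇\*_{U,μ}** — one model X → X × (P × P) with block map `blk ∘ Prod.fst`, block
bound √|P × P|·(B₂ + B₂θB₂(1 − B₂θc²)⁻¹c²)·Λ′·e^{−(ρ−αρ₀)d(y,y′)}: `l2bd_right_of_step` for every pair from `Thm33G0L2P.l5 q`, then `blockBd_familyOp`.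
[cite: Balaban1985BackgroundPropagators, Thm 3.12 p.423 + (3.46) p.398 + (3.39) p.397; Balaban1984PropagatorsII, Lemma 2.1 p.234] -/
theorem l2bd_family5_of_step [Fintype P] (hG : GeoOK g) {𝔬 : Ops g B X Y Z W} {Dd Dds : B.Cfg → P → Module.End ℝ (X → ℝ)} {U : B.Cfg}
    {T A : Module.End ℝ (X → ℝ)} {B₂ θ δ₁ ρ ρ₀ α Λ σ c : ℝ} (hrow : RowSum (toB6 g R₀ H₀) σ c)
    (hB₂ : 0 ≤ B₂) (hθ : 0 ≤ θ) (hρ : 0 ≤ ρ) (hσ : 0 ≤ σ) (hρδ : ρ + 2 * σ ≤ δ₁) (hΛ : 0 ≤ Λ)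
    (hST : ScaleTransfer g ρ₀ α Λ (fun y => g.len y ^ (-1 : ℝ)))
    (hL : Thm33G0L2P 𝔬 Dd Dds R₀ H₀ B₂ δ₁ U)
    (hT : BlockBd (g := toB6 g R₀ H₀) 𝔬.blk 𝔬.blk T
      (fun (y y' : g.Site) => θ * (g.len y)⁻¹ * (g.len y')⁻¹ * Real.exp (-(δ₁ * g.dist y y'))))
    (hfix : A = 𝔬.G0 U + 𝔬.G0 U ∘ₗ T ∘ₗ A) (hq : B₂ * θ * c * c < 1) :
    BlockBd (g := toB6 g R₀ H₀) 𝔬.blk (𝔬.blk ∘ Prod.fst) (familyOp (fun q : P × P => A ∘ₗ (Dds U q.1 ∘ₗ Dds U q.2)))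
      (fun (y y' : g.Site) => Real.sqrt (Fintype.card (P × P)) * ((B₂ + B₂ * (θ * (B₂ * (1 - B₂ * θ * c * c)⁻¹) * c) * c) * Λ *
        Real.exp (-((ρ - α * ρ₀) * g.dist y y')))) := by
  have hc : 0 ≤ c ∨ IsEmpty g.Site := by
    by_cases hne : Nonempty g.Site
    · exact Or.inl (hrow.nonneg hne.some)
    · exact Or.inr (not_nonempty_iff.mp hne)
  rcases hc with hc | hemp
  swap
  · intro y' μ hμ y
    exact (hemp.false y).elim
  have hq1 : 0 ≤ (1 - B₂ * θ * c * c)⁻¹ := inv_nonneg.mpr (by linarith)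
  have hK0 : 0 ≤ B₂ + B₂ * (θ * (B₂ * (1 - B₂ * θ * c * c)⁻¹) * c) * c :=
    add_nonneg hB₂ (mul_nonneg (mul_nonneg hB₂ (mul_nonneg (mul_nonneg hθ (mul_nonneg hB₂ hq1)) hc)) hc)
  exact blockBd_familyOp (R := R₀) (H := H₀) 𝔬.blk 𝔬.blk
    (fun a b => mul_nonneg (mul_nonneg hK0 hΛ) (Real.exp_nonneg _))
    fun q => l2bd_right_of_step hG hrow hB₂ hθ hρ hσ hρδ hST hL.l0 (hL.l5 q) hT hfix hq

end Second

/-! ## §3 One member, one U, one propagator: both blocks from the schemas, neighbourhood reading -/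

section OneMember

variable {g : B9.Geometry} {B : B9.Backgrounds} {X Y Z W PX PY P : Type}
variable [Fintype X] [Fintype Y] [Fintype PX] [Fintype PY] [Fintype P] [Fintype g.Site] [DecidableEq g.Site]
variable {R₀ : ℝ} {H₀ : Prop}

/-- **The L² constant of one propagator, pair-packaged second-order lines**: B₀(1 − θc)⁻¹Λ₁ (line 0), (C₁ + B₀(1 − θc)⁻¹)Λ_h (lines 1, 2),
K₄(1 + N_PΛ₁ + N_PΛ₋) (lines 4, 3, 5), K₄ = B₂ + B₂θ₂B₂(1 − B₂θ₂c²)⁻¹c², N_P = √|P × P| (the packaging constant of `familyOp`).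
[cite: Balaban1985BackgroundPropagators, (3.46) p.398 + Thm 3.12 p.423] -/
def constL2N (B₀ θ θD B₂ θ₂ c Λ₁ Λh Λm NP : ℝ) : ℝ :=
  B₀ * (1 - θ * c)⁻¹ * Λ₁ + (B₀ + θD * (B₀ * (1 - θ * c)⁻¹) * c + B₀ * (1 - θ * c)⁻¹) * Λh +
    (B₂ + B₂ * (θ₂ * (B₂ * (1 - B₂ * θ₂ * c * c)⁻¹) * c) * c) * (1 + NP * Λ₁ + NP * Λm)

/-- ★ **THEOREM 3.12 — THE L² BLOCK (3.46) OF A KERNEL FAMILY CO-READ ON THE NEIGHBOURHOOD BY ONE SECT.-D PROPAGATOR, AT ONE MEMBER AND ONE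
CONFIGURATION, FROM THE SCHEMAS** (the Nbr twin of `…BlocksRel.l2Block_of_step`, lines 3∕5 as packaged pair families).  Data at U: A with
(Δ_a − T)A = I and G₀Δ_a = I; Theorem 3.3 for G₀ in the sup classes (`he0 he1 he2`) and the block-L² classes with the second-order members per
pair (`hL2 : Thm33G0L2P …`); the perturbation step on 𝔠⁽¹⁾, 𝔠⁽²⁾ (`hK1 hK2`), its derivative (`hKD`) and its block-L² bound (`hT2`); A symmetric and
(∇_UA)ᵀ = A∇\*_U; [4] Lemma 2.1 as the row sum at σ and three scale transfers (γ = 1, ½, −1); the co-readings `L2ReadsNbr` of `K.l2 0…5` by A, ∇_UA,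
A∇\*_U, the family ∇_ν∇_μA (into X × (P × P)), ∇_UA∇\*_U, the family A∇\*_ν∇\*_μ; the class data (m, saturation of d in the second argument), the
neighbourhood data (radius r, mN, CL ≧ 1, Cev ≧ 0).  Provisos: ρ ≦ δ₀, ρ + σ ≦ δ_K, θc < 1, B₂θ₂c² < 1, 0 ≦ ρ_f, ρ_f + σ ≦ (1 − α)ρ, ρ_f + 2σ + αρ ≦ ρ.
Conclusion: `L2Block K (mN·m·Cev·CL²·e^{rρ_f}·constL2N …) ρ_f U`.  Nothing of print asserted.
[cite: Balaban1985BackgroundPropagators, Thm 3.12 p.423 + Thm 3.3 p.399 + (3.46) p.398 + (3.39) p.397 + (3.130)–(3.131) pp.421–422 + (3.138) p.423; Balaban1984PropagatorsII, (2.51)–(2.52) p.232 + Lemma 2.1 (2.60)–(2.61) p.234] -/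
theorem l2Block_of_step_nbr (hG : GeoOK g) {K : B9.KernelFamily g B} {U : B.Cfg} (𝔬 : Ops g B X Y Z W)
    (Dd Dds : B.Cfg → P → Module.End ℝ (X → ℝ)) (Rel : g.Site → g.Site → Prop) [DecidableRel Rel]
    (ev : g.Loc → X → ℝ) (evY : g.Loc → Y → ℝ) {A T : Module.End ℝ (X → ℝ)} {m mN : ℕ}
    {r Cev CL θ θD θ₂ B₀ B₂ δ₀ δK ρ ρf σ α c Λ₁ Λh Λm : ℝ}
    (hrow : RowSum (toB6 g R₀ H₀) σ c)
    (hθ : 0 ≤ θ) (hθD : 0 ≤ θD) (hθ₂ : 0 ≤ θ₂) (hB₀ : 0 ≤ B₀) (hB₂ : 0 ≤ B₂) (hσ : 0 ≤ σ) (hα : 0 ≤ α)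
    (hρ : 0 ≤ ρ) (hρS : ρ ≤ δ₀) (hρδ : ρ + σ ≤ δK) (hq : θ * c < 1) (hq₂ : B₂ * θ₂ * c * c < 1)
    (hρf : 0 ≤ ρf) (hρf1 : ρf + σ ≤ (1 - α) * ρ) (hρf2 : ρf + 2 * σ + α * ρ ≤ ρ)
    (hΛ₁ : 0 ≤ Λ₁) (hΛh : 0 ≤ Λh) (hΛm : 0 ≤ Λm)
    (hST1 : ScaleTransfer g ρ α Λ₁ (fun y => g.len y ^ (1 : ℝ)))
    (hSTh : ScaleTransfer g ρ α Λh (fun y => g.len y ^ (1 / 2 : ℝ)))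
    (hSTm : ScaleTransfer g ρ α Λm (fun y => g.len y ^ (-1 : ℝ)))
    (hI0 : 𝔬.G0 U * 𝔬.S0 U = 1) (hIA : (𝔬.S0 U - T) * A = 1)
    (he0 : HasMajorant (g := toB6 g R₀ H₀) 𝔬.blk (𝔬.G0 U) (fun a b => B₀ * g.len a ^ 2 * Real.exp (-(δ₀ * g.dist a b))))
    (he1 : HasMajorantHom (g := toB6 g R₀ H₀) 𝔬.blk 𝔬.blkY (𝔬.D U ∘ₗ 𝔬.G0 U)
      (fun (a b : g.Site) => B₀ * g.len a * Real.exp (-(δ₀ * g.dist a b))))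
    (he2 : HasMajorantHom (g := toB6 g R₀ H₀) 𝔬.blkY 𝔬.blk (𝔬.G0 U ∘ₗ 𝔬.Dstar U)
      (fun (a b : g.Site) => B₀ * g.len a * Real.exp (-(δ₀ * g.dist a b))))
    (hL2 : Thm33G0L2P 𝔬 Dd Dds R₀ H₀ B₂ δ₀ U)
    (hK1 : HasMaj (cNorm R₀ H₀ 𝔬.blk hG.lenle 1) (cNorm R₀ H₀ 𝔬.blk hG.lenle 1) (𝔬.G0 U ∘ₗ T)
      (fun a b => θ * Real.exp (-(δK * g.dist a b))))
    (hK2 : HasMaj (cNorm R₀ H₀ 𝔬.blk hG.lenle 2) (cNorm R₀ H₀ 𝔬.blk hG.lenle 2) (𝔬.G0 U ∘ₗ T)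
      (fun a b => θ * Real.exp (-(δK * g.dist a b))))
    (hKD : HasMaj (cNorm R₀ H₀ 𝔬.blk hG.lenle 2) (cNorm R₀ H₀ 𝔬.blkY hG.lenle 1) (𝔬.D U ∘ₗ 𝔬.G0 U ∘ₗ T)
      (fun a b => θD * Real.exp (-(δK * g.dist a b))))
    (hT2 : BlockBd (g := toB6 g R₀ H₀) 𝔬.blk 𝔬.blk T
      (fun (y y' : g.Site) => θ₂ * (g.len y)⁻¹ * (g.len y')⁻¹ * Real.exp (-(δK * g.dist y y'))))
    (hsym : IsTransposePair A A) (htr : IsTransposePair (𝔬.D U ∘ₗ A) (A ∘ₗ 𝔬.Dstar U))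
    (hRd₂ : ∀ a b b', Rel b b' → g.dist a b = g.dist a b')
    (hmult : ∀ y' : g.Site, (Finset.univ.filter (fun y'' => Rel y'' y')).card ≤ m)
    (hnbr : ∀ y : g.Site, (nbr g r y).card ≤ mN)
    (hCL1 : 1 ≤ CL) (hCL : ∀ a a' : g.Site, g.dist a a' ≤ r → g.len a ≤ CL * g.len a') (hCev : 0 ≤ Cev)
    (hl0 : L2ReadsNbr (R := R₀) (H := H₀) K 0 U Rel r Cev 𝔬.blk 𝔬.blk ev A)
    (hl1 : L2ReadsNbr (R := R₀) (H := H₀) K 1 U Rel r Cev 𝔬.blkY 𝔬.blk ev (𝔬.D U ∘ₗ A))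
    (hl2 : L2ReadsNbr (R := R₀) (H := H₀) K 2 U Rel r Cev 𝔬.blk 𝔬.blkY evY (A ∘ₗ 𝔬.Dstar U))
    (hl3 : L2ReadsNbr (R := R₀) (H := H₀) K 3 U Rel r Cev (𝔬.blk ∘ Prod.fst) 𝔬.blk ev
      (familyOp (fun q : P × P => (Dd U q.1 ∘ₗ Dd U q.2) ∘ₗ A)))
    (hl4 : L2ReadsNbr (R := R₀) (H := H₀) K 4 U Rel r Cev 𝔬.blkY 𝔬.blkY evY (𝔬.D U ∘ₗ (A ∘ₗ 𝔬.Dstar U)))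
    (hl5 : L2ReadsNbr (R := R₀) (H := H₀) K 5 U Rel r Cev (𝔬.blk ∘ Prod.fst) 𝔬.blk ev
      (familyOp (fun q : P × P => A ∘ₗ (Dds U q.1 ∘ₗ Dds U q.2)))) :
    L2Block K (mN * m * Cev * CL ^ 2 * Real.exp (r * ρf) *
      constL2N B₀ θ θD B₂ θ₂ c Λ₁ Λh Λm (Real.sqrt (Fintype.card (P × P)))) ρf U := by
  -- adapted from `B9Thm312WholeBlocksRel.l2Block_of_step` (lines 3∕5 re-modelled, Nbr engines)
  have hc : 0 ≤ c ∨ IsEmpty g.Site := by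
    by_cases hne : Nonempty g.Site
    · exact Or.inl (hrow.nonneg hne.some)
    · exact Or.inr (not_nonempty_iff.mp hne)
  rcases hc with hc | hemp
  swap
  · exact fun n lam h y => (hemp.false y).elim
  -- constants
  set NP : ℝ := Real.sqrt (Fintype.card (P × P)) with hNP
  have hNP0 : 0 ≤ NP := Real.sqrt_nonneg _
  have hq1 : 0 ≤ (1 - θ * c)⁻¹ := inv_nonneg.mpr (by linarith)
  have hB₀'0 : 0 ≤ B₀ * (1 - θ * c)⁻¹ := mul_nonneg hB₀ hq1
  have hC₁0 : 0 ≤ B₀ + θD * (B₀ * (1 - θ * c)⁻¹) * c := add_nonneg hB₀ (mul_nonneg (mul_nonneg hθD hB₀'0) hc)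
  have hq₂1 : 0 ≤ (1 - B₂ * θ₂ * c * c)⁻¹ := inv_nonneg.mpr (by linarith)
  have hK₄0 : 0 ≤ B₂ + B₂ * (θ₂ * (B₂ * (1 - B₂ * θ₂ * c * c)⁻¹) * c) * c :=
    add_nonneg hB₂ (mul_nonneg (mul_nonneg hB₂ (mul_nonneg (mul_nonneg hθ₂ (mul_nonneg hB₂ hq₂1)) hc)) hc)
  have ha0 : 0 ≤ B₀ * (1 - θ * c)⁻¹ * Λ₁ := mul_nonneg hB₀'0 hΛ₁
  have hb0 : 0 ≤ (B₀ + θD * (B₀ * (1 - θ * c)⁻¹) * c + B₀ * (1 - θ * c)⁻¹) * Λh := mul_nonneg (add_nonneg hC₁0 hB₀'0) hΛh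
  have hNP1 : 0 ≤ NP * Λ₁ := mul_nonneg hNP0 hΛ₁
  have hNPm : 0 ≤ NP * Λm := mul_nonneg hNP0 hΛm
  have hs1 : 1 ≤ 1 + NP * Λ₁ + NP * Λm := by linarith
  have hc0 : B₂ + B₂ * (θ₂ * (B₂ * (1 - B₂ * θ₂ * c * c)⁻¹) * c) * c ≤
      (B₂ + B₂ * (θ₂ * (B₂ * (1 - B₂ * θ₂ * c * c)⁻¹) * c) * c) * (1 + NP * Λ₁ + NP * Λm) :=
    le_mul_of_one_le_right hK₄0 hs1
  have hc3 : (B₂ + B₂ * (θ₂ * (B₂ * (1 - B₂ * θ₂ * c * c)⁻¹) * c) * c) * (NP * Λ₁) ≤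
      (B₂ + B₂ * (θ₂ * (B₂ * (1 - B₂ * θ₂ * c * c)⁻¹) * c) * c) * (1 + NP * Λ₁ + NP * Λm) :=
    mul_le_mul_of_nonneg_left (by linarith) hK₄0
  have hc5 : (B₂ + B₂ * (θ₂ * (B₂ * (1 - B₂ * θ₂ * c * c)⁻¹) * c) * c) * (NP * Λm) ≤
      (B₂ + B₂ * (θ₂ * (B₂ * (1 - B₂ * θ₂ * c * c)⁻¹) * c) * c) * (1 + NP * Λ₁ + NP * Λm) :=
    mul_le_mul_of_nonneg_left (by linarith) hK₄0
  have hcc : 0 ≤ (B₂ + B₂ * (θ₂ * (B₂ * (1 - B₂ * θ₂ * c * c)⁻¹) * c) * c) * (1 + NP * Λ₁ + NP * Λm) :=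
    mul_nonneg hK₄0 (by linarith)
  have hKL0 : 0 ≤ constL2N B₀ θ θD B₂ θ₂ c Λ₁ Λh Λm NP := by unfold constL2N; linarith
  have hKLa : B₀ * (1 - θ * c)⁻¹ * Λ₁ ≤ constL2N B₀ θ θD B₂ θ₂ c Λ₁ Λh Λm NP := by unfold constL2N; linarith
  have hKLb : (B₀ + θD * (B₀ * (1 - θ * c)⁻¹) * c + B₀ * (1 - θ * c)⁻¹) * Λh ≤ constL2N B₀ θ θD B₂ θ₂ c Λ₁ Λh Λm NP := by
    unfold constL2N; linarith
  have hKL4 : B₂ + B₂ * (θ₂ * (B₂ * (1 - B₂ * θ₂ * c * c)⁻¹) * c) * c ≤ constL2N B₀ θ θD B₂ θ₂ c Λ₁ Λh Λm NP := by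
    unfold constL2N; linarith
  have hKL3 : (B₂ + B₂ * (θ₂ * (B₂ * (1 - B₂ * θ₂ * c * c)⁻¹) * c) * c) * (NP * Λ₁) ≤ constL2N B₀ θ θD B₂ θ₂ c Λ₁ Λh Λm NP := by
    unfold constL2N; linarith
  have hKL5 : (B₂ + B₂ * (θ₂ * (B₂ * (1 - B₂ * θ₂ * c * c)⁻¹) * c) * c) * (NP * Λm) ≤ constL2N B₀ θ θD B₂ θ₂ c Λ₁ Λh Λm NP := by
    unfold constL2N; linarith
  -- rates
  have hαρ : 0 ≤ α * ρ := mul_nonneg hα hρ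
  have hρf_le : ρf ≤ (1 - α) * ρ := by linarith
  have h1αρ : (1 - α) * ρ ≤ ρ := by linarith
  have hρL0 : 0 ≤ ρf + α * ρ := add_nonneg hρf hαρ
  have hρL2 : ρf + α * ρ + 2 * σ ≤ ρ := by linarith
  have hexp : ∀ {r₁ r' : ℝ}, r' ≤ r₁ → ∀ y y' : g.Site, Real.exp (-(r₁ * g.dist y y')) ≤ Real.exp (-(r' * g.dist y y')) :=
    fun h y y' => Real.exp_le_exp.mpr (neg_le_neg (mul_le_mul_of_nonneg_right h (hG.dnn y y')))
  -- (3.130)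
  have hfix : A = 𝔬.G0 U + 𝔬.G0 U ∘ₗ T ∘ₗ A := fix_of_inverses hI0 hIA
  -- the sup majorants of A, ∇_UA, A∇* (proved upstream)
  have hm0 := entry0_of_step hG hrow hθ hB₀ hρ hρS hρδ hK2 he0 hfix hq
  have hm1 := entry1_of_stepD hG hrow hθ hθD hB₀ hρ hρS hρδ hK2 hKD he0 he1 hfix hq
  have hm2 := entry2_of_step hG hrow hθ hB₀ hρ hρS hρδ hK1 he2 hfix hq
  -- lines 0, 1, 2 by Schur
  have hb0 := l2bd_entry0_of_sup (R₀ := R₀) (H₀ := H₀) hG hB₀'0 hST1 hm0 hsym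
  have hm1' : HasMajorantHom (g := toB6 g R₀ H₀) 𝔬.blk 𝔬.blkY (𝔬.D U ∘ₗ A)
      (fun (a b : g.Site) => (B₀ + θD * (B₀ * (1 - θ * c)⁻¹) * c + B₀ * (1 - θ * c)⁻¹) * g.len a *
        Real.exp (-(ρ * g.dist a b))) :=
    hasMajorantHom_mono (g := toB6 g R₀ H₀) 𝔬.blk 𝔬.blkY hm1 fun a b =>
      mul_le_mul_of_nonneg_right (mul_le_mul_of_nonneg_right (by linarith) (hG.lenle a)) (Real.exp_nonneg _)
  have hm2' : HasMajorantHom (g := toB6 g R₀ H₀) 𝔬.blkY 𝔬.blk (A ∘ₗ 𝔬.Dstar U)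
      (fun (a b : g.Site) => (B₀ + θD * (B₀ * (1 - θ * c)⁻¹) * c + B₀ * (1 - θ * c)⁻¹) * g.len a *
        Real.exp (-(ρ * g.dist a b))) :=
    hasMajorantHom_mono (g := toB6 g R₀ H₀) 𝔬.blkY 𝔬.blk hm2 fun a b =>
      mul_le_mul_of_nonneg_right (mul_le_mul_of_nonneg_right (by linarith) (hG.lenle a)) (Real.exp_nonneg _)
  obtain ⟨hb1, hb2⟩ := l2bd_entry12_of_sup (R₀ := R₀) (H₀ := H₀) hG (add_nonneg hC₁0 hB₀'0) hSTh hm1' hm2' htr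
  -- lines 3, 4, 5 by r1's Neumann bookkeeping at the rate ρf + αρ (schemas brought to the common rate ρ)
  have hL2ρ : Thm33G0L2P 𝔬 Dd Dds R₀ H₀ B₂ ρ U := by
    have hl : ∀ y : g.Site, 0 ≤ g.len y := hG.lenle
    have hli : ∀ y : g.Site, 0 ≤ (g.len y)⁻¹ := fun y => inv_nonneg.mpr (hl y)
    exact
      { l0 := hL2.l0.mono fun y y' => mul_le_mul_of_nonneg_left (hexp hρS y y') (mul_nonneg (mul_nonneg hB₂ (hl y)) (hl y'))
        l1 := hL2.l1.mono fun y y' => mul_le_mul_of_nonneg_left (hexp hρS y y') (mul_nonneg hB₂ (hl y'))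
        l2 := hL2.l2.mono fun y y' => mul_le_mul_of_nonneg_left (hexp hρS y y') (mul_nonneg hB₂ (hl y))
        l3 := fun q => (hL2.l3 q).mono fun y y' =>
          mul_le_mul_of_nonneg_left (hexp hρS y y') (mul_nonneg hB₂ (mul_nonneg (hli y) (hl y')))
        l4 := hL2.l4.mono fun y y' => mul_le_mul_of_nonneg_left (hexp hρS y y') hB₂
        l5 := fun q => (hL2.l5 q).mono fun y y' =>
          mul_le_mul_of_nonneg_left (hexp hρS y y') (mul_nonneg hB₂ (mul_nonneg (hl y) (hli y'))) }
  have hT2ρ : BlockBd (g := toB6 g R₀ H₀) 𝔬.blk 𝔬.blk T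
      (fun (y y' : g.Site) => θ₂ * (g.len y)⁻¹ * (g.len y')⁻¹ * Real.exp (-(ρ * g.dist y y'))) :=
    hT2.mono fun y y' => mul_le_mul_of_nonneg_left (hexp (by linarith) y y')
      (mul_nonneg (mul_nonneg hθ₂ (inv_nonneg.mpr (hG.lenle y))) (inv_nonneg.mpr (hG.lenle y')))
  have hb4 := l2bd_entry4_of_step (Lap := fun _ => (0 : Module.End ℝ (X → ℝ))) hG hrow hB₂ hθ₂ hρL0 hσ hρL2
    (Thm33G0L2P.toLap hB₂ hG.lenle hL2ρ) hT2ρ hfix hq₂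
  have hb3 := l2bd_family3_of_step hG hrow hB₂ hθ₂ hρL0 hσ hρL2 hΛ₁ hST1 hL2ρ hT2ρ hfix hq₂
  have hb5 := l2bd_family5_of_step hG hrow hB₂ hθ₂ hρL0 hσ hρL2 hΛm hSTm hL2ρ hT2ρ hfix hq₂
  have hρL' : ρf + α * ρ - α * ρ = ρf := by ring
  rw [hρL'] at hb3 hb5
  -- all six at (constL2N, ρf) in the pref6 shapes
  have hP : ∀ t : ℝ, B9.pref6 t 0 = t ^ 2 ∧ B9.pref6 t 1 = t ∧ B9.pref6 t 2 = t ∧ B9.pref6 t 3 = 1 ∧ B9.pref6 t 4 = 1 ∧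
      B9.pref6 t 5 = 1 := fun t => by simp [B9.pref6]
  have hw : ∀ {Kx r₁ : ℝ} (Pw : g.Site → ℝ), (∀ y, 0 ≤ Pw y) → Kx ≤ constL2N B₀ θ θD B₂ θ₂ c Λ₁ Λh Λm NP → ρf ≤ r₁ →
      ∀ y y' : g.Site, Kx * Pw y * Real.exp (-(r₁ * g.dist y y')) ≤
        constL2N B₀ θ θD B₂ θ₂ c Λ₁ Λh Λm NP * Pw y * Real.exp (-(ρf * g.dist y y')) :=
    fun Pw hPw hK hr₁ y y' => mul_le_mul (mul_le_mul_of_nonneg_right hK (hPw y)) (hexp hr₁ y y') (Real.exp_nonneg _)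
      (mul_nonneg hKL0 (hPw y))
  have hB0 : BlockBd (g := toB6 g R₀ H₀) 𝔬.blk 𝔬.blk A
      (fun (y y' : g.Site) => constL2N B₀ θ θD B₂ θ₂ c Λ₁ Λh Λm NP * B9.pref6 (g.len y) 0 * Real.exp (-(ρf * g.dist y y'))) := by
    refine hb0.mono fun y y' => ?_
    rw [(hP (g.len y)).1]
    have h := hw (Kx := B₀ * (1 - θ * c)⁻¹ * Λ₁) (r₁ := (1 - α) * ρ) (fun y => g.len y ^ 2) (fun y => sq_nonneg _) hKLa
      hρf_le y y'
    simpa only [mul_assoc] using h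
  have hB1 : BlockBd (g := toB6 g R₀ H₀) 𝔬.blk 𝔬.blkY (𝔬.D U ∘ₗ A)
      (fun (y y' : g.Site) => constL2N B₀ θ θD B₂ θ₂ c Λ₁ Λh Λm NP * B9.pref6 (g.len y) 1 * Real.exp (-(ρf * g.dist y y'))) := by
    refine hb1.mono fun y y' => ?_
    rw [(hP (g.len y)).2.1]
    have h := hw (Kx := (B₀ + θD * (B₀ * (1 - θ * c)⁻¹) * c + B₀ * (1 - θ * c)⁻¹) * Λh) (r₁ := (1 - α) * ρ)
      (fun y => g.len y) hG.lenle hKLb hρf_le y y'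
    simpa only [mul_assoc] using h
  have hB2 : BlockBd (g := toB6 g R₀ H₀) 𝔬.blkY 𝔬.blk (A ∘ₗ 𝔬.Dstar U)
      (fun (y y' : g.Site) => constL2N B₀ θ θD B₂ θ₂ c Λ₁ Λh Λm NP * B9.pref6 (g.len y) 2 * Real.exp (-(ρf * g.dist y y'))) := by
    refine hb2.mono fun y y' => ?_
    rw [(hP (g.len y)).2.2.1]
    have h := hw (Kx := (B₀ + θD * (B₀ * (1 - θ * c)⁻¹) * c + B₀ * (1 - θ * c)⁻¹) * Λh) (r₁ := (1 - α) * ρ)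
      (fun y => g.len y) hG.lenle hKLb hρf_le y y'
    simpa only [mul_assoc] using h
  have hB3 : BlockBd (g := toB6 g R₀ H₀) 𝔬.blk (𝔬.blk ∘ Prod.fst) (familyOp (fun q : P × P => (Dd U q.1 ∘ₗ Dd U q.2) ∘ₗ A))
      (fun (y y' : g.Site) => constL2N B₀ θ θD B₂ θ₂ c Λ₁ Λh Λm NP * B9.pref6 (g.len y) 3 * Real.exp (-(ρf * g.dist y y'))) := by
    refine hb3.mono fun y y' => ?_
    rw [(hP (g.len y)).2.2.2.1, mul_one]
    calc NP * ((B₂ + B₂ * (θ₂ * (B₂ * (1 - B₂ * θ₂ * c * c)⁻¹) * c) * c) * Λ₁ * Real.exp (-(ρf * g.dist y y')))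
        = (B₂ + B₂ * (θ₂ * (B₂ * (1 - B₂ * θ₂ * c * c)⁻¹) * c) * c) * (NP * Λ₁) * Real.exp (-(ρf * g.dist y y')) := by ring
      _ ≤ constL2N B₀ θ θD B₂ θ₂ c Λ₁ Λh Λm NP * Real.exp (-(ρf * g.dist y y')) :=
          mul_le_mul_of_nonneg_right hKL3 (Real.exp_nonneg _)
  have hB4 : BlockBd (g := toB6 g R₀ H₀) 𝔬.blkY 𝔬.blkY (𝔬.D U ∘ₗ (A ∘ₗ 𝔬.Dstar U))
      (fun (y y' : g.Site) => constL2N B₀ θ θD B₂ θ₂ c Λ₁ Λh Λm NP * B9.pref6 (g.len y) 4 * Real.exp (-(ρf * g.dist y y'))) := by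
    refine hb4.mono fun y y' => ?_
    rw [(hP (g.len y)).2.2.2.2.1, mul_one]
    exact mul_le_mul hKL4 (hexp (by linarith) y y') (Real.exp_nonneg _) hKL0
  have hB5 : BlockBd (g := toB6 g R₀ H₀) 𝔬.blk (𝔬.blk ∘ Prod.fst) (familyOp (fun q : P × P => A ∘ₗ (Dds U q.1 ∘ₗ Dds U q.2)))
      (fun (y y' : g.Site) => constL2N B₀ θ θD B₂ θ₂ c Λ₁ Λh Λm NP * B9.pref6 (g.len y) 5 * Real.exp (-(ρf * g.dist y y'))) := by
    refine hb5.mono fun y y' => ?_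
    rw [(hP (g.len y)).2.2.2.2.2, mul_one]
    calc NP * ((B₂ + B₂ * (θ₂ * (B₂ * (1 - B₂ * θ₂ * c * c)⁻¹) * c) * c) * Λm * Real.exp (-(ρf * g.dist y y')))
        = (B₂ + B₂ * (θ₂ * (B₂ * (1 - B₂ * θ₂ * c * c)⁻¹) * c) * c) * (NP * Λm) * Real.exp (-(ρf * g.dist y y')) := by ring
      _ ≤ constL2N B₀ θ θD B₂ θ₂ c Λ₁ Λh Λm NP * Real.exp (-(ρf * g.dist y y')) :=
          mul_le_mul_of_nonneg_right hKL5 (Real.exp_nonneg _)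
  exact l2Block_of_blockBds_nbr (R := R₀) (H := H₀) hG hRd₂ hmult hnbr hCL1 hCL hCev hKL0 hρf hB0 hB1 hB2 hB3 hB4 hB5
    hl0 hl1 hl2 hl3 hl4 hl5

/-- ★ **THEOREM 3.12 — THE HÖLDER BLOCK (3.43)–(3.45) OF A KERNEL FAMILY CO-READ ON THE NEIGHBOURHOOD BY ONE SECT.-D PROPAGATOR, AT ONE MEMBER
AND ONE CONFIGURATION, FROM THE SCHEMAS** (the Nbr twin of `…BlocksRel.holder_of_step`).  Data at U: A with (Δ_a − T)A = I and G₀Δ_a = I;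
Theorem 3.3 for G₀ — (3.42)₁,₂,₃ (`he0 he1 he2`) and the Hölder members through the probes and input norms (`hH0 : Thm33G0H …`); the
perturbation step on 𝔠⁽¹⁾, 𝔠⁽²⁾ (`hK1 hK2`), its derivative (`hKD`) and its Hölder-class members (`hpY hpX htD`); [4] Lemma 2.1 as the row sum at
σ and the scale transfer at γ = 1; the co-readings `H1ReadsNbr` (of `K.h1` by ∇_UA, A∇\*_U, probes within distance r of y) and `InputReadsNbr`
(of `K.e4`, `K.h2` by ∇_UA∇\*_U); the class data and the neighbourhood data (r ≧ 0, CL ≧ 1).  Provisos: ρ ≦ δ₀, ρ + σ ≦ δ_K, θc < 1, 0 ≦ ρ_f,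
ρ_f + σ ≦ (1 − α)ρ.  Conclusion: `B9.Ineq343_345 K (m·CL·e^{rρ_f}·(B_h + θ_HB₀(1 − θc)⁻¹c)) (e^{rρ_f}·(B_i + C₁Λ₁θ_Hc))
(CL·e^{rρ_f}·(B_i2 + (B_h + θ_HB₀(1 − θc)⁻¹c)Λ₁θ_Hc)) ρ_f U`, C₁ = B₀ + θ_DB₀(1 − θc)⁻¹c.  Nothing of print asserted.
[cite: Balaban1985BackgroundPropagators, Thm 3.12 p.423 + Thm 3.3 p.399 + (3.43)–(3.45) p.398 + (3.40) p.397 + (3.130)–(3.131) pp.421–422 + (3.138) p.423; Balaban1984PropagatorsII, (2.51)–(2.52) p.232 + Lemma 2.1 (2.60)–(2.61) p.234] -/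
theorem holder_of_step_nbr (hG : GeoOK g) {K : B9.KernelFamily g B} {U : B.Cfg} (𝔬 : Ops g B X Y Z W)
    (𝔭 : HolderProbes g B X Y PX PY) (bH : ℝ → BlockNorm (toB6 g R₀ H₀) (Y → ℝ))
    (Rel : g.Site → g.Site → Prop) [DecidableRel Rel] (ev : g.Loc → X → ℝ) (evY : g.Loc → Y → ℝ)
    {A T : Module.End ℝ (X → ℝ)} {m : ℕ}
    {r CL θ θD θH B₀ δ₀ δK ρ ρf σ α c Λ₁ : ℝ} {Bh Bi : ℝ → ℝ} {Bi2 : ℝ → ℝ → ℝ}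
    (hrow : RowSum (toB6 g R₀ H₀) σ c)
    (hθ : 0 ≤ θ) (hθD : 0 ≤ θD) (hθH : 0 ≤ θH) (hB₀ : 0 ≤ B₀) (hσ : 0 ≤ σ) (hα : 0 ≤ α)
    (hρ : 0 ≤ ρ) (hρS : ρ ≤ δ₀) (hρδ : ρ + σ ≤ δK) (hq : θ * c < 1)
    (hρf : 0 ≤ ρf) (hρf1 : ρf + σ ≤ (1 - α) * ρ) (hΛ₁ : 0 ≤ Λ₁)
    (hBh : ∀ β, 0 ≤ β → β < 1 → 0 ≤ Bh β) (hBi : ∀ ε, 0 < ε → ε ≤ 1 → 0 ≤ Bi ε)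
    (hBi2 : ∀ ε β, 0 < ε → ε ≤ 1 → 0 ≤ β → β < 1 → 0 ≤ Bi2 ε β)
    (hST1 : ScaleTransfer g ρ α Λ₁ (fun y => g.len y ^ (1 : ℝ)))
    (hI0 : 𝔬.G0 U * 𝔬.S0 U = 1) (hIA : (𝔬.S0 U - T) * A = 1)
    (he0 : HasMajorant (g := toB6 g R₀ H₀) 𝔬.blk (𝔬.G0 U) (fun a b => B₀ * g.len a ^ 2 * Real.exp (-(δ₀ * g.dist a b))))
    (he1 : HasMajorantHom (g := toB6 g R₀ H₀) 𝔬.blk 𝔬.blkY (𝔬.D U ∘ₗ 𝔬.G0 U)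
      (fun (a b : g.Site) => B₀ * g.len a * Real.exp (-(δ₀ * g.dist a b))))
    (he2 : HasMajorantHom (g := toB6 g R₀ H₀) 𝔬.blkY 𝔬.blk (𝔬.G0 U ∘ₗ 𝔬.Dstar U)
      (fun (a b : g.Site) => B₀ * g.len a * Real.exp (-(δ₀ * g.dist a b))))
    (hH0 : Thm33G0H 𝔬 𝔭 R₀ H₀ bH Bh Bi Bi2 δ₀ U)
    (hK1 : HasMaj (cNorm R₀ H₀ 𝔬.blk hG.lenle 1) (cNorm R₀ H₀ 𝔬.blk hG.lenle 1) (𝔬.G0 U ∘ₗ T)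
      (fun a b => θ * Real.exp (-(δK * g.dist a b))))
    (hK2 : HasMaj (cNorm R₀ H₀ 𝔬.blk hG.lenle 2) (cNorm R₀ H₀ 𝔬.blk hG.lenle 2) (𝔬.G0 U ∘ₗ T)
      (fun a b => θ * Real.exp (-(δK * g.dist a b))))
    (hKD : HasMaj (cNorm R₀ H₀ 𝔬.blk hG.lenle 2) (cNorm R₀ H₀ 𝔬.blkY hG.lenle 1) (𝔬.D U ∘ₗ 𝔬.G0 U ∘ₗ T)
      (fun a b => θD * Real.exp (-(δK * g.dist a b))))
    (hpY : ∀ β : ℝ, 0 ≤ β → β < 1 → HasMaj (cNormR R₀ H₀ 𝔬.blk hG.lenle (-2)) (cNormR R₀ H₀ 𝔭.blkPY hG.lenle (β - 1))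
      ((𝔭.ΦY U β ∘ₗ 𝔬.D U ∘ₗ 𝔬.G0 U) ∘ₗ T) (fun a b => θH * Real.exp (-(δK * g.dist a b))))
    (hpX : ∀ β : ℝ, 0 ≤ β → β < 1 → HasMaj (cNormR R₀ H₀ 𝔬.blk hG.lenle (-1)) (cNormR R₀ H₀ 𝔭.blkPX hG.lenle (β - 1))
      ((𝔭.ΦX U β ∘ₗ 𝔬.G0 U) ∘ₗ T) (fun a b => θH * Real.exp (-(δK * g.dist a b))))
    (htD : ∀ ε : ℝ, 0 < ε → HasMaj (bH ε) (cNormR R₀ H₀ 𝔬.blk hG.lenle 1) (T ∘ₗ (𝔬.G0 U ∘ₗ 𝔬.Dstar U))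
      (fun a b => θH * Real.exp (-(δK * g.dist a b))))
    (hRd₂ : ∀ a b b', Rel b b' → g.dist a b = g.dist a b')
    (hmult : ∀ y' : g.Site, (Finset.univ.filter (fun y'' => Rel y'' y')).card ≤ m)
    (hCL1 : 1 ≤ CL) (hCL : ∀ a a' : g.Site, g.dist a a' ≤ r → g.len a ≤ CL * g.len a')
    (hH1 : H1ReadsNbr K U 𝔭 Rel r 𝔬.blk 𝔬.blkY ev evY (𝔬.D U ∘ₗ A) (A ∘ₗ 𝔬.Dstar U))
    (hIR : InputReadsNbr K U 𝔭 bH r 𝔬.blkY evY (𝔬.D U ∘ₗ (A ∘ₗ 𝔬.Dstar U))) :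
    B9.Ineq343_345 K (fun β => m * CL * Real.exp (r * ρf) * (Bh β + θH * (B₀ * (1 - θ * c)⁻¹) * c))
      (fun ε => Real.exp (r * ρf) * (Bi ε + (B₀ + θD * (B₀ * (1 - θ * c)⁻¹) * c) * Λ₁ * θH * c))
      (fun ε β => CL * Real.exp (r * ρf) * (Bi2 ε β + (Bh β + θH * (B₀ * (1 - θ * c)⁻¹) * c) * Λ₁ * θH * c)) ρf U := by
  -- adapted from `B9Thm312WholeBlocksRel.holder_of_step` (Nbr engines)
  have hc : 0 ≤ c ∨ IsEmpty g.Site := by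
    by_cases hne : Nonempty g.Site
    · exact Or.inl (hrow.nonneg hne.some)
    · exact Or.inr (not_nonempty_iff.mp hne)
  rcases hc with hc | hemp
  swap
  · exact ⟨fun β lam ζ y => (hemp.false y).elim, fun ε lam y => (hemp.false y).elim, fun ε β lam ζ y => (hemp.false y).elim⟩
  have hq1 : 0 ≤ (1 - θ * c)⁻¹ := inv_nonneg.mpr (by linarith)
  have hB₀'0 : 0 ≤ B₀ * (1 - θ * c)⁻¹ := mul_nonneg hB₀ hq1
  have hC₁0 : 0 ≤ B₀ + θD * (B₀ * (1 - θ * c)⁻¹) * c := add_nonneg hB₀ (mul_nonneg (mul_nonneg hθD hB₀'0) hc)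
  have hαρ : 0 ≤ α * ρ := mul_nonneg hα hρ
  have hρfρ : ρf ≤ ρ := by linarith
  have hρfK : ρf ≤ δK := by linarith
  have hρf0 : ρf ≤ δ₀ := hρfρ.trans hρS
  have hexp : ∀ {r₁ r' : ℝ}, r' ≤ r₁ → ∀ y y' : g.Site, Real.exp (-(r₁ * g.dist y y')) ≤ Real.exp (-(r' * g.dist y y')) :=
    fun h y y' => Real.exp_le_exp.mpr (neg_le_neg (mul_le_mul_of_nonneg_right h (hG.dnn y y')))
  have hfix : A = 𝔬.G0 U + 𝔬.G0 U ∘ₗ T ∘ₗ A := fix_of_inverses hI0 hIA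
  have hfixR : A = 𝔬.G0 U + A ∘ₗ T ∘ₗ 𝔬.G0 U := fix_right_of_inverses hI0 hIA
  have hm1 := entry1_of_stepD hG hrow hθ hθD hB₀ hρ hρS hρδ hK2 hKD he0 he1 hfix hq
  have hBhA : ∀ β, 0 ≤ β → β < 1 → 0 ≤ Bh β + θH * (B₀ * (1 - θ * c)⁻¹) * c := fun β h0 h1 =>
    add_nonneg (hBh β h0 h1) (mul_nonneg (mul_nonneg hθH hB₀'0) hc)
  -- (3.43) at the rate ρ, weakened to ρf
  have h43L : ∀ β, 0 ≤ β → β < 1 → HasMajorantHom (g := toB6 g R₀ H₀) 𝔬.blk 𝔭.blkPY (𝔭.ΦY U β ∘ₗ (𝔬.D U ∘ₗ A))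
      (fun (a b : g.Site) => (Bh β + θH * (B₀ * (1 - θ * c)⁻¹) * c) * g.len a ^ (1 - β) * Real.exp (-(ρf * g.dist a b))) := by
    intro β h0 h1
    have h := probe43L_of_step hG 𝔭 hrow hθ hθH hB₀ (hBh β h0 h1) hρ hρS hρδ hK2 he0 (hH0.h43L β h0 h1) (hpY β h0 h1) hfix hq
    exact hasMajorantHom_mono (g := toB6 g R₀ H₀) 𝔬.blk 𝔭.blkPY h fun a b =>
      mul_le_mul_of_nonneg_left (hexp hρfρ a b) (mul_nonneg (hBhA β h0 h1) (Real.rpow_nonneg (hG.lenle a) _))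
  have h43R : ∀ β, 0 ≤ β → β < 1 → HasMajorantHom (g := toB6 g R₀ H₀) 𝔬.blkY 𝔭.blkPX (𝔭.ΦX U β ∘ₗ (A ∘ₗ 𝔬.Dstar U))
      (fun (a b : g.Site) => (Bh β + θH * (B₀ * (1 - θ * c)⁻¹) * c) * g.len a ^ (1 - β) * Real.exp (-(ρf * g.dist a b))) := by
    intro β h0 h1
    have h := probe43R_of_step hG 𝔭 hrow hθ hθH hB₀ (hBh β h0 h1) hρ hρS hρδ hK1 he2 (hH0.h43R β h0 h1) (hpX β h0 h1) hfix hq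
    exact hasMajorantHom_mono (g := toB6 g R₀ H₀) 𝔬.blkY 𝔭.blkPX h fun a b =>
      mul_le_mul_of_nonneg_left (hexp hρfρ a b) (mul_nonneg (hBhA β h0 h1) (Real.rpow_nonneg (hG.lenle a) _))
  -- (3.44), (3.45) at the rate ρf through the right form
  have h44 : ∀ ε, 0 < ε → ε ≤ 1 → HasMaj (bH ε) (BlockNorm.ofBlocks (toB6 g R₀ H₀) 𝔬.blkY) (𝔬.D U ∘ₗ (A ∘ₗ 𝔬.Dstar U))
      (fun (a b : g.Site) => (Bi ε + (B₀ + θD * (B₀ * (1 - θ * c)⁻¹) * c) * Λ₁ * θH * c) *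
        Real.exp (-(ρf * g.dist a b))) := fun ε h0 h1 =>
    input44_of_step hG hrow hθH (hBi ε h0 h1) hC₁0 hΛ₁ hρf hρf1 hρfK hρf0 hST1 hm1 (hH0.h44 ε h0 h1) (htD ε h0) hfixR
  have h45 : ∀ ε β, 0 < ε → ε ≤ 1 → 0 ≤ β → β < 1 →
      HasMaj (bH (β + ε)) (BlockNorm.ofBlocks (toB6 g R₀ H₀) 𝔭.blkPY) (𝔭.ΦY U β ∘ₗ (𝔬.D U ∘ₗ (A ∘ₗ 𝔬.Dstar U)))
        (fun (a b : g.Site) => (Bi2 ε β + (Bh β + θH * (B₀ * (1 - θ * c)⁻¹) * c) * Λ₁ * θH * c) * g.len a ^ (-β) *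
          Real.exp (-(ρf * g.dist a b))) := by
    intro ε β hε0 hε1 h0 h1
    have h43' : HasMajorantHom (g := toB6 g R₀ H₀) 𝔬.blk 𝔭.blkPY (((𝔭.ΦY U β ∘ₗ 𝔬.D U) ∘ₗ 𝔬.G0 U))
        (fun (a b : g.Site) => Bh β * g.len a ^ (1 - β) * Real.exp (-(δ₀ * g.dist a b))) := hH0.h43L β h0 h1
    have hA := probe43L_cNormR hG hrow hθ hθH hB₀ (hBh β h0 h1) hρ hρS hρδ hK2 he0 h43' (hpY β h0 h1) hfix hq
    have h := input45_of_step hG hrow hθH (hBi2 ε β hε0 hε1 h0 h1) (hBhA β h0 h1) hΛ₁ hρf hρf1 hρfK hρf0 hST1 hA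
      (hH0.h45 ε β hε0 hε1 h0 h1) (htD (β + ε) (by linarith)) hfixR
    exact h.congr fun μ => rfl
  exact ineq343_345_of_majorants_nbr (R := R₀) (H := H₀) hG 𝔭 bH hRd₂ hmult hCL1 hCL hBhA
    (fun ε h0 h1 => add_nonneg (hBi ε h0 h1) (mul_nonneg (mul_nonneg (mul_nonneg hC₁0 hΛ₁) hθH) hc))
    (fun ε β hε0 hε1 h0 h1 => add_nonneg (hBi2 ε β hε0 hε1 h0 h1)
      (mul_nonneg (mul_nonneg (mul_nonneg (hBhA β h0 h1) hΛ₁) hθH) hc))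
    hρf h43L h43R h44 h45 hH1 hIR

end OneMember

end

end Literature.MathematicalPhysics.QuantumFieldTheory.Balaban1983to89.B9Thm312WholeBlocksNbr
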